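import Summits.PneNP.PneNP.Theses.BruckRyserSos

/-!
# PneNP / BruckRyserSos — the orthogonal-orbit pseudoexpectation (`DegreeTwoOrbitBlind`)

Route `PneNP/BruckRyserSos`, support item stmt-PneNP-16764 (`DegreeTwoOrbitBlind`, provable now):
for all `(v, k, λ)` with `2 ≤ v`, `λ ≤ k ≤ v`, `λ (v - 1) = k (k - 1)` the DESIGN SYSTEM `D(v,k,λ)`
(indeterminates `x_(p,B) = X (p v + B)`, `p, B < v`; identities row sums `= k`, column sums `= k`,
row inner products `= λ`, column inner products `= λ`, Booleanity `x² = x`) admits a degree-2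
pseudoexpectation (tree `IsPseudoexpectation` / `SatisfiesIdentity`, Kothari–Mori–O'Donnell–Witmer
2017, Defs. 2.7–2.8) — whether or not a symmetric `(v,k,λ)`-design exists.

## The construction (a finite stand-in for the Haar orbit measure)

Put `α = √(k - λ)`, `β = (k - α) / v` and, for a shift `a : Fin v`, let `M⁽ᵃ⁾ = α Πₐ + β J`, where
`Πₐ` is the permutation matrix of `B = p + a (mod v)`. Every `M⁽ᵃ⁾` is a REAL solution of the
quadratic design equations: its row and column sums are `α + v β = k`, and two distinct rows (or
columns) have inner product `2 α β + v β² = λ` (this is where `λ (v - 1) = k (k - 1)` enters: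
`k² - α² = k² - k + λ = λ v`). So the genuine expectation "evaluate at `M⁽ᵃ⁾`" satisfies every
design identity in every degree and is positive semidefinite in every degree; only Booleanity fails
pointwise. Averaging over the `v` shifts `a` repairs Booleanity IN DEGREE 2, i.e. ON AVERAGE: every
cell is on the shifted diagonal for exactly one `a`, so `E[x] = ((α + β) + (v - 1) β) / v = k / v`
and `E[x²] = ((α + β)² + (v - 1) β²) / v = (α² + 2αβ + vβ²) / v = k / v`. (The route's description
averages over the stabiliser of `𝟙` in `O(v)`; the cyclic shifts are a finite sub-orbit with the
same first two cell moments, which is all degree 2 sees.) Indeterminates off the board are read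
through `(w / v mod v, w mod v)`, so Booleanity holds for every `w : ℕ` by the same count.

References: Kothari–Mori–O'Donnell–Witmer, *Sum of squares lower bounds for refuting any CSP*
(STOC 2017), Defs. 2.7–2.8; M. Laurent, *A comparison of the Sherali–Adams, Lovász–Schrijver, and
Lasserre relaxations for 0-1 programming*, Math. Oper. Res. 28 (2003) (moment matrices);
H. J. Ryser, *Combinatorial Mathematics* (1963), Ch. 8 (the design equations `A Aᵀ = Aᵀ A =
(k - λ) I + λ J`, `λ (v - 1) = k (k - 1)`).
-/

set_option linter.dupNamespace false -- `Summit.PneNP.PneNP.…`: summit = sub-problem name (D-0017 single-conjunct layout)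

noncomputable section

open MvPolynomial Finset
open Literature.Computability.MetaComplexity

namespace Summit.PneNP.PneNP.Theorems

/-! ### Averages of evaluations are pseudoexpectations -/

/-- Applying the uniform average of finitely many evaluation functionals. [folklore] -/
theorem avgEval_apply {ι : Type*} [Fintype ι] (pt : ι → ℕ → ℝ) (q : MvPolynomial ℕ ℝ) :
    ((Fintype.card ι : ℝ)⁻¹ • ∑ i : ι, (MvPolynomial.aeval (pt i)).toLinearMap :
      MvPolynomial ℕ ℝ →ₗ[ℝ] ℝ) q = (Fintype.card ι : ℝ)⁻¹ * ∑ i : ι, MvPolynomial.aeval (pt i) q := by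
  simp only [LinearMap.smul_apply, LinearMap.coe_sum, Finset.sum_apply, AlgHom.toLinearMap_apply,
    smul_eq_mul]

/-- The uniform average of finitely many (at least one) evaluation functionals is a
pseudoexpectation of every degree: a genuine expectation is positive semidefinite in all degrees.
(Kothari–Mori–O'Donnell–Witmer 2017, §2.3.) [folklore] -/
theorem isPseudoexpectation_avgEval {ι : Type*} [Fintype ι] [Nonempty ι] (pt : ι → ℕ → ℝ)
    (d : ℕ) :
    IsPseudoexpectation d
      ((Fintype.card ι : ℝ)⁻¹ • ∑ i : ι, (MvPolynomial.aeval (pt i)).toLinearMap) := by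
  refine ⟨?_, fun p _ => ?_⟩
  · rw [avgEval_apply]
    simp only [map_one, Finset.sum_const, Finset.card_univ, nsmul_eq_mul, mul_one]
    exact inv_mul_cancel₀ (Nat.cast_ne_zero.2 Fintype.card_ne_zero)
  · rw [avgEval_apply]
    refine mul_nonneg (inv_nonneg.2 (Nat.cast_nonneg _)) (Finset.sum_nonneg fun i _ => ?_)
    rw [map_mul]
    exact mul_self_nonneg _

/-- An identity `q = 0` that holds AT EVERY POINT of the average is satisfied in every degree.
[folklore] -/
theorem satisfiesIdentity_avgEval_of_forall {ι : Type*} [Fintype ι] (pt : ι → ℕ → ℝ) (d : ℕ)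
    (q : MvPolynomial ℕ ℝ) (hq : ∀ i, MvPolynomial.aeval (pt i) q = 0) :
    SatisfiesIdentity d
      ((Fintype.card ι : ℝ)⁻¹ • ∑ i : ι, (MvPolynomial.aeval (pt i)).toLinearMap) q := by
  intro r _
  rw [avgEval_apply]
  refine mul_eq_zero_of_right _ (Finset.sum_eq_zero fun i _ => ?_)
  rw [map_mul, hq i, zero_mul]

/-- The Booleanity axiom `x_w² - x_w` has total degree exactly `2`. [folklore] -/
theorem totalDegree_boolAxiom (w : ℕ) : (boolAxiom w).totalDegree = 2 := by
  apply le_antisymm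
  · calc (boolAxiom w).totalDegree
        ≤ max ((X w ^ 2 : MvPolynomial ℕ ℝ).totalDegree) ((X w : MvPolynomial ℕ ℝ).totalDegree) :=
          totalDegree_sub _ _
      _ = 2 := by rw [totalDegree_X_pow, totalDegree_X]; rfl
  · have h : (X w ^ 2 : MvPolynomial ℕ ℝ) = boolAxiom w + X w := by
      simp only [boolAxiom, sub_add_cancel]
    have h2 : (X w ^ 2 : MvPolynomial ℕ ℝ).totalDegree ≤
        max (boolAxiom w).totalDegree ((X w : MvPolynomial ℕ ℝ).totalDegree) := by
      rw [h]; exact totalDegree_add _ _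
    rw [totalDegree_X_pow, totalDegree_X] at h2
    omega

/-- Booleanity ON AVERAGE: if `∑ᵢ ptᵢ(w)² = ∑ᵢ ptᵢ(w)` then the average of the evaluations at the
points `ptᵢ` satisfies `x_w² - x_w = 0` in degree `2` (the cofactor `r` is then a constant).
[folklore] -/
theorem satisfiesIdentity_two_avgEval_boolAxiom {ι : Type*} [Fintype ι] (pt : ι → ℕ → ℝ) (w : ℕ)
    (h : ∑ i, pt i w ^ 2 = ∑ i, pt i w) :
    SatisfiesIdentity 2
      ((Fintype.card ι : ℝ)⁻¹ • ∑ i : ι, (MvPolynomial.aeval (pt i)).toLinearMap) (boolAxiom w) := by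
  intro r hr
  rw [totalDegree_boolAxiom] at hr
  have hr0 : r.totalDegree = 0 := by omega
  rw [totalDegree_eq_zero_iff_eq_C] at hr0
  rw [hr0, avgEval_apply]
  refine mul_eq_zero_of_right _ ?_
  simp only [map_mul, boolAxiom, map_sub, map_pow, aeval_X, aeval_C, Algebra.algebraMap_self_apply]
  rw [← Finset.sum_mul, Finset.sum_sub_distrib, h, sub_self, zero_mul]

/-! ### Counting over the cyclic shifts -/

/-- One marked cell: `∑_{a : Fin v} (a = t ? x : y) = x + (v - 1) y`. [folklore] -/
theorem sum_ite_eq_fin {v : ℕ} (t : Fin v) (x y : ℝ) :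
    ∑ a : Fin v, (if a = t then x else y) = x + ((v : ℝ) - 1) * y := by
  have h : ∀ a : Fin v, (if a = t then x else y) = y + (if a = t then x - y else 0) := by
    intro a; split_ifs <;> ring
  simp_rw [h]
  rw [Finset.sum_add_distrib, Finset.sum_const, Finset.card_univ, Fintype.card_fin,
    Finset.sum_ite_eq', if_pos (Finset.mem_univ _), nsmul_eq_mul]
  ring

/-- Two distinct marked cells:
`∑_{a : Fin v} (a = t ? x : y) · (a = t' ? x : y) = 2 x y + (v - 2) y²` for `t ≠ t'`. [folklore] -/
theorem sum_ite_mul_ite_fin {v : ℕ} {t t' : Fin v} (htt : t ≠ t') (x y : ℝ) :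
    ∑ a : Fin v, ((if a = t then x else y) * (if a = t' then x else y)) =
      2 * x * y + ((v : ℝ) - 2) * y ^ 2 := by
  have h : ∀ a : Fin v, (if a = t then x else y) * (if a = t' then x else y) =
      y ^ 2 + (if a = t then x * y - y ^ 2 else 0) + (if a = t' then x * y - y ^ 2 else 0) := by
    intro a
    by_cases h1 : a = t
    · have h2 : a ≠ t' := fun h2 => htt (h1.symm.trans h2)
      rw [if_pos h1, if_neg h2, if_pos h1, if_neg h2]; ring
    · by_cases h2 : a = t'
      · rw [if_neg h1, if_pos h2, if_neg h1, if_pos h2]; ring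
      · rw [if_neg h1, if_neg h2, if_neg h1, if_neg h2]; ring
  simp_rw [h]
  rw [Finset.sum_add_distrib, Finset.sum_add_distrib, Finset.sum_const, Finset.card_univ,
    Fintype.card_fin, Finset.sum_ite_eq', if_pos (Finset.mem_univ _), Finset.sum_ite_eq',
    if_pos (Finset.mem_univ _), nsmul_eq_mul]
  ring

/-- Re-indexing a shifted diagonal by the shift: `r = c + a ↔ a = r - c` in `Fin v`. [folklore] -/
theorem eq_add_iff_eq_sub_fin {v : ℕ} [NeZero v] (r c a : Fin v) : (r = c + a) ↔ (a = r - c) := by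
  rw [eq_sub_iff_add_eq, add_comm, eq_comm]

/-- Re-indexing a shifted diagonal by the row: `B = p + a ↔ p = B - a` in `Fin v`. [folklore] -/
theorem eq_add_iff_eq_sub_fin' {v : ℕ} [NeZero v] (B p a : Fin v) : (B = p + a) ↔ (p = B - a) := by
  rw [eq_sub_iff_add_eq, eq_comm]

/-- Decoding a cell index: for `p, B < v`, `(p v + B) mod v = B` and `((p v + B) / v) mod v = p`.
[folklore] -/
theorem cell_index_decode {v p B : ℕ} (hp : p < v) (hB : B < v) :
    (p * v + B) % v = B ∧ (p * v + B) / v % v = p := by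
  have hv : 0 < v := lt_of_le_of_lt (Nat.zero_le _) hB
  constructor
  · rw [Nat.mul_add_mod_self_right, Nat.mod_eq_of_lt hB]
  · rw [mul_comm, Nat.mul_add_div hv, Nat.div_eq_of_lt hB, add_zero, Nat.mod_eq_of_lt hp]

/-! ### The theorem -/

/-- **The orthogonal-orbit pseudoexpectation** (route BruckRyserSos, support item
stmt-PneNP-16764 `DegreeTwoOrbitBlind`): for all `(v,k,λ)` with `2 ≤ v`, `λ ≤ k ≤ v`,
`λ (v-1) = k (k-1)`, the design system `D(v,k,λ)` admits a degree-2 pseudoexpectation satisfying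
Booleanity, the row/column-sum identities (`= k`) and the row/column inner-product identities
(`= λ`). Witness: the uniform average over the `v` cyclic shifts `a` of the evaluations at the real
solutions `M⁽ᵃ⁾ = α Πₐ + β J`, `α = √(k-λ)`, `β = (k-α)/v` (module docstring); the design identities
hold at every point, Booleanity holds on average (`E[x] = E[x²] = k/v`), and an average of
evaluations is positive semidefinite in every degree. In particular degree-2 SOS / Sherali–Adams
does not refute `¬PP(6)`, `¬PP(10)`, `¬D(22,7,2)`. (Kothari–Mori–O'Donnell–Witmer 2017,
Defs. 2.7–2.8; Laurent 2003; Ryser 1963, Ch. 8.) [folklore] -/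
theorem degreeTwoOrbitBlind_proof :
    Summit.PneNP.PneNP.Theses.BruckRyserSos.DegreeTwoOrbitBlind := by
  unfold Summit.PneNP.PneNP.Theses.BruckRyserSos.DegreeTwoOrbitBlind
  intro v k lam hv hlk hkv hdes
  haveI : NeZero v := ⟨by omega⟩
  have hv0 : 0 < v := by omega
  have hvR : (v : ℝ) ≠ 0 := by exact_mod_cast hv0.ne'
  -- the arithmetic of the parameters: `λ v = k² - k + λ`
  have hnat : lam * v + k = k * k + lam := by
    obtain ⟨v', rfl⟩ : ∃ v', v = v' + 1 := ⟨v - 1, by omega⟩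
    rw [Nat.add_sub_cancel] at hdes
    rcases Nat.eq_zero_or_pos k with rfl | hk
    · have h0 : lam = 0 := by omega
      subst h0; simp
    · obtain ⟨k', rfl⟩ : ∃ k', k = k' + 1 := ⟨k - 1, by omega⟩
      rw [Nat.add_sub_cancel] at hdes
      nlinarith [hdes]
  have hR : (lam : ℝ) * v = (k : ℝ) * k - k + lam := by
    have h := congrArg (Nat.cast : ℕ → ℝ) hnat
    push_cast at h
    linarith
  set α : ℝ := Real.sqrt ((k : ℝ) - lam) with hα
  have hα2 : α ^ 2 = (k : ℝ) - lam := by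
    rw [hα, Real.sq_sqrt]
    exact sub_nonneg.2 (by exact_mod_cast hlk)
  set β : ℝ := ((k : ℝ) - α) / v with hβ
  have hvβ : (v : ℝ) * β = k - α := by rw [hβ]; field_simp
  have hA1 : α + (v : ℝ) * β = k := by rw [hvβ]; ring
  have hA2 : 2 * α * β + (v : ℝ) * β ^ 2 = lam := by
    apply mul_left_cancel₀ hvR
    have e : (v : ℝ) * (2 * α * β + (v : ℝ) * β ^ 2) =
        2 * α * ((v : ℝ) * β) + ((v : ℝ) * β) ^ 2 := by ring
    rw [e, hvβ]
    linear_combination -hα2 - hR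
  have hA3 : (α + β) ^ 2 + ((v : ℝ) - 1) * β ^ 2 = k := by linear_combination hα2 + hA2
  -- the cell coordinates of an indeterminate and the shifted orbit points `M⁽ᵃ⁾`
  let κ : ℕ → Fin v := fun w => ⟨w % v, Nat.mod_lt _ hv0⟩
  let ρ : ℕ → Fin v := fun w => ⟨w / v % v, Nat.mod_lt _ hv0⟩
  let pt : Fin v → ℕ → ℝ := fun a w => if κ w = ρ w + a then α + β else β
  have hcell : ∀ p B : ℕ, ∀ hp : p < v, ∀ hB : B < v,
      κ (p * v + B) = ⟨B, hB⟩ ∧ ρ (p * v + B) = ⟨p, hp⟩ := by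
    intro p B hp hB
    obtain ⟨h1, h2⟩ := cell_index_decode hp hB
    exact ⟨Fin.ext h1, Fin.ext h2⟩
  have hpt : ∀ (a : Fin v) (p B : ℕ) (hp : p < v) (hB : B < v),
      pt a (p * v + B) = if (⟨B, hB⟩ : Fin v) = ⟨p, hp⟩ + a then α + β else β := by
    intro a p B hp hB
    obtain ⟨h1, h2⟩ := hcell p B hp hB
    show (if κ (p * v + B) = ρ (p * v + B) + a then α + β else β) = _
    rw [h1, h2]
  refine ⟨(Fintype.card (Fin v) : ℝ)⁻¹ • ∑ a : Fin v, (MvPolynomial.aeval (pt a)).toLinearMap,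
    isPseudoexpectation_avgEval pt 2, fun w => ?_, fun p hp => ?_, fun B hB => ?_,
    fun p hp p' hp' hpp => ?_, fun B hB B' hB' hBB => ?_⟩
  · -- Booleanity, on average over the shifts
    apply satisfiesIdentity_two_avgEval_boolAxiom
    have e1 : ∀ a : Fin v, pt a w = if a = κ w - ρ w then α + β else β := by
      intro a
      show (if κ w = ρ w + a then α + β else β) = _
      by_cases h : a = κ w - ρ w
      · rw [if_pos h, if_pos ((eq_add_iff_eq_sub_fin _ _ _).2 h)]
      · rw [if_neg h, if_neg (fun h' => h ((eq_add_iff_eq_sub_fin _ _ _).1 h'))]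
    have e2 : ∀ a : Fin v, pt a w ^ 2 = if a = κ w - ρ w then (α + β) ^ 2 else β ^ 2 := by
      intro a; rw [e1]; split_ifs <;> rfl
    simp_rw [e2, e1]
    rw [sum_ite_eq_fin, sum_ite_eq_fin, hA3]
    linear_combination -hA1
  · -- row sums `∑_B x_(p,B) = k`: exact at every point
    apply satisfiesIdentity_avgEval_of_forall
    intro a
    simp only [map_sub, map_sum, aeval_X, aeval_C, Algebra.algebraMap_self_apply]
    rw [sub_eq_zero, Finset.sum_range (fun B => pt a (p * v + B))]
    have e : ∀ B : Fin v, pt a (p * v + (B : ℕ)) = if B = ⟨p, hp⟩ + a then α + β else β := by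
      intro B
      rw [hpt a p B hp B.isLt]
    simp_rw [e]
    rw [sum_ite_eq_fin]
    linear_combination hA1
  · -- column sums `∑_p x_(p,B) = k`: exact at every point
    apply satisfiesIdentity_avgEval_of_forall
    intro a
    simp only [map_sub, map_sum, aeval_X, aeval_C, Algebra.algebraMap_self_apply]
    rw [sub_eq_zero, Finset.sum_range (fun p => pt a (p * v + B))]
    have e : ∀ p : Fin v, pt a ((p : ℕ) * v + B) = if p = ⟨B, hB⟩ - a then α + β else β := by
      intro p
      rw [hpt a p B p.isLt hB]
      by_cases h : p = ⟨B, hB⟩ - a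
      · rw [if_pos h, if_pos ((eq_add_iff_eq_sub_fin' _ _ _).2 h)]
      · rw [if_neg h, if_neg (fun h' => h ((eq_add_iff_eq_sub_fin' _ _ _).1 h'))]
    simp_rw [e]
    rw [sum_ite_eq_fin]
    linear_combination hA1
  · -- row inner products `∑_B x_(p,B) x_(p',B) = λ` (`p ≠ p'`): exact at every point
    apply satisfiesIdentity_avgEval_of_forall
    intro a
    simp only [map_sub, map_sum, map_mul, aeval_X, aeval_C, Algebra.algebraMap_self_apply]
    rw [sub_eq_zero, Finset.sum_range (fun B => pt a (p * v + B) * pt a (p' * v + B))]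
    have e : ∀ B : Fin v, pt a (p * v + (B : ℕ)) * pt a (p' * v + (B : ℕ)) =
        (if B = ⟨p, hp⟩ + a then α + β else β) * (if B = ⟨p', hp'⟩ + a then α + β else β) := by
      intro B
      rw [hpt a p B hp B.isLt, hpt a p' B hp' B.isLt]
    simp_rw [e]
    have hne : (⟨p, hp⟩ : Fin v) + a ≠ ⟨p', hp'⟩ + a := by
      intro h
      exact hpp (Fin.mk.inj_iff.1 (add_right_cancel h))
    rw [sum_ite_mul_ite_fin hne]
    linear_combination hA2
  · -- column inner products `∑_p x_(p,B) x_(p,B') = λ` (`B ≠ B'`): exact at every point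
    apply satisfiesIdentity_avgEval_of_forall
    intro a
    simp only [map_sub, map_sum, map_mul, aeval_X, aeval_C, Algebra.algebraMap_self_apply]
    rw [sub_eq_zero, Finset.sum_range (fun p => pt a (p * v + B) * pt a (p * v + B'))]
    have e : ∀ p : Fin v, pt a ((p : ℕ) * v + B) * pt a ((p : ℕ) * v + B') =
        (if p = ⟨B, hB⟩ - a then α + β else β) * (if p = ⟨B', hB'⟩ - a then α + β else β) := by
      intro p
      rw [hpt a p B p.isLt hB, hpt a p B' p.isLt hB']
      congr 1
      · by_cases h : p = ⟨B, hB⟩ - a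
        · rw [if_pos h, if_pos ((eq_add_iff_eq_sub_fin' _ _ _).2 h)]
        · rw [if_neg h, if_neg (fun h' => h ((eq_add_iff_eq_sub_fin' _ _ _).1 h'))]
      · by_cases h : p = ⟨B', hB'⟩ - a
        · rw [if_pos h, if_pos ((eq_add_iff_eq_sub_fin' _ _ _).2 h)]
        · rw [if_neg h, if_neg (fun h' => h ((eq_add_iff_eq_sub_fin' _ _ _).1 h'))]
    simp_rw [e]
    have hne : (⟨B, hB⟩ : Fin v) - a ≠ ⟨B', hB'⟩ - a := by
      intro h
      exact hBB (Fin.mk.inj_iff.1 (sub_left_injective h))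
    rw [sum_ite_mul_ite_fin hne]
    linear_combination hA2

end Summit.PneNP.PneNP.Theorems
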